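import Summits.RiemannHypothesis.RiemannHypothesis.Theorems.GroundBartaEvenWinsBeyondArchDeflationPanelQLoc2
import Literature.NumberTheory.LFunctions.WeilArchDensityRhoPanelTM
import HarnessLib

/-!
# RiemannHypothesis / GroundBarta — rung 4 (`EvenWinsBeyondArch`, stmt-RiemannHypothesis-18807 / 18085):
# the deflated Temple L-side, XIX d′ — window/vector bundles from kernel checks, `s_i` from the per-panel `q_j` (v2)

Helper file (`--supports stmt-RiemannHypothesis-18807`), RH-free, Mathlib + landed tree files only, no facts.  Prover B,
speedrun unit `sr-gb-rung-b` (gen 4).  The two ends of a generated per-window R-layer certificate (v2, R-LAYER.md §10):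
* START — entry-by-entry makers of the bundles `dt_WinL` / `dt_VecL` of file XIX b′: ρ-panel models (`dt_rho_entryL`,
  `dt_panelsL_cons`), their moments (`dt_momsL`, `dt_mem_momsL_of_eq`), G-moments on panel 0 (`dt_gmoms0L`,
  `dt_mem_gmoms0L_of_eq`), the even-grid local table of a vector (`dt_tabEntryL`, `dt_tabOK_of_eq`, `dt_tabL_spec`), the
  pole enclosures (`dt_mem_poleCosh/Sinh` of file XV′ from chunked `dt_poleSumI` facts), the constants (file XIX c);
  every kernel fact enters as an EQUATION `computed = literal` proven by `decide` in its own small theorem, so no chunk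
  exceeds the kernel budget;
* END — `dt_hs_of_panelQL`: the per-panel bounds give `∫‖F_i − Σ_l W_il v_l‖² ≤ 2 Σ_{j<m} q_j` (sigma-criterion input).

References: E. Bombieri, Rend. Mat. Acc. Lincei (9) 11 (2000) Thm 2 [Bombieri2000Weil]; Goerisch–Haunhorst (1985)
[GoerischHaunhorst1985].

-/

set_option linter.dupNamespace false

noncomputable section

open MeasureTheory Set Filter intervalIntegral
open scoped Topology BigOperators

namespace Summit.RiemannHypothesis.RiemannHypothesis.Theorems.EvenWinsBeyondArch

open Literature.NumberTheory.LFunctions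
open Literature.Analysis.ValidatedNumerics Literature.Analysis.ValidatedNumerics.PolyMP
  Literature.Analysis.ValidatedNumerics.NumericsMP Literature.Analysis.ValidatedNumerics.ExpPoly

/-! ## Panel models from per-panel checks -/

/-- `PolyMP.panelCentre (c/(2m)) j = (2j+1)·(c/(2m))` over `ℝ`. -/
theorem dt_panelCentre_castL (c : ℚ) (m j : ℕ) :
    ((PolyMP.panelCentre (c / (2 * m)) j : ℚ) : ℝ) = (2 * j + 1) * ((c : ℝ) / (2 * m)) := by
  simp only [PolyMP.panelCentre]
  push_cast
  ring

section Panels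

variable {S : ℕ} {h : ℚ} {w : ℝ → ℝ}

/-- The empty list of panel models (base of the generated entry-by-entry proofs). -/
theorem dt_panelsL_nil (j : ℕ) :
    ∀ i : Fin ([] : List (IPoly × Poly)).length,
      TMem S h (fun u ↦ w ((PolyMP.panelCentre h (j + i) : ℝ) + u)) (([] : List (IPoly × Poly)).get i).1 :=
  fun i ↦ i.elim0

/-- One more panel model in front: entry `j` from its own certificate, entries `j+1, …` from the tail. -/
theorem dt_panelsL_cons {j : ℕ} {e : IPoly × Poly} {rest : List (IPoly × Poly)}
    (h0 : TMem S h (fun u ↦ w ((PolyMP.panelCentre h j : ℝ) + u)) e.1)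
    (hr : ∀ i : Fin rest.length, TMem S h (fun u ↦ w ((PolyMP.panelCentre h (j + 1 + i) : ℝ) + u)) (rest.get i).1) :
    ∀ i : Fin (e :: rest).length, TMem S h (fun u ↦ w ((PolyMP.panelCentre h (j + i) : ℝ) + u)) ((e :: rest).get i).1
  | ⟨0, _⟩ => by simpa using h0
  | ⟨n + 1, hn⟩ => by
      have := hr ⟨n, by simpa using hn⟩
      simp only [List.get_eq_getElem, List.getElem_cons_succ] at this ⊢
      rw [show j + (n + 1) = j + 1 + n by ring]
      exact this

/-- The `hDG` field from the entry-by-entry form started at `0`. -/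
theorem dt_hDG_of_panelsL {DG : List (IPoly × Poly)}
    (hD : ∀ i : Fin DG.length, TMem S h (fun u ↦ weilArchDensityG ((PolyMP.panelCentre h (0 + i) : ℝ) + u)) (DG.get i).1) :
    ∀ i : Fin DG.length, TMem S h (fun u ↦ weilArchDensityG ((PolyMP.panelCentre h i : ℝ) + u)) (DG.get i).1 := by
  intro i
  have := hD i
  rw [zero_add] at this
  exact this

/-- The `hDρ` field from the entry-by-entry form of the TAIL started at `1` (entry `0` of `Dρ` is never used). -/
theorem dt_hDρ_of_panelsL {e0 : IPoly × Poly} {rest : List (IPoly × Poly)}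
    (hD : ∀ i : Fin rest.length, TMem S h (fun u ↦ weilArchDensity ((PolyMP.panelCentre h (1 + i) : ℝ) + u)) (rest.get i).1) :
    ∀ i : Fin (e0 :: rest).length, 1 ≤ (i : ℕ) →
      TMem S h (fun u ↦ weilArchDensity ((PolyMP.panelCentre h i : ℝ) + u)) ((e0 :: rest).get i).1
  | ⟨0, _⟩, hi => absurd hi (by norm_num)
  | ⟨n + 1, hn⟩, _ => by
      have := hD ⟨n, by simpa using hn⟩
      simp only [List.get_eq_getElem, List.getElem_cons_succ] at this ⊢
      rw [show 1 + n = n + 1 by ring] at this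
      exact this

end Panels

/-- **One `G`-panel entry** from A's `gPanelCheck` (unit slope) at the centre `t_j = (2j+1)h`. -/
theorem dt_G_entryL {S : ℕ} (hS : 0 < S) {h : ℚ} (h0 : 0 ≤ h) (hh2 : h ≤ 2) {D K Kφ lam Ke ke : ℕ} (hK : 0 < K)
    (hKφ : 0 < Kφ) (hlam : 0 < lam) (j : ℕ) {Q : List ℤ} {e : ℕ}
    (hchk : gPanelCheck S h D Kφ lam Ke ke (PolyMP.panelCentre h j) 1 Q e = true) :
    TMem S h (fun u ↦ weilArchDensityG ((PolyMP.panelCentre h j : ℝ) + u))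
      (gPanelI S h D K Ke ke (PolyMP.panelCentre h j) 1 Q e) := by
  have hc : 1 * h ≤ PolyMP.panelCentre h j := by
    simp only [PolyMP.panelCentre]
    have : (0 : ℚ) ≤ j := by exact_mod_cast Nat.zero_le j
    nlinarith
  have hT := tmem_gPanel hS h0 one_pos (by rw [one_mul]; exact hh2) hK hKφ hlam hc hchk
  intro u hu
  obtain ⟨as, has, hev⟩ := hT u hu
  refine ⟨as, has, ?_⟩
  rw [← hev]
  push_cast
  rw [one_mul]

/-- **One `ρ`-panel entry** from `rhoPanelCheck` at the centre `t_j` (the check enforces `h < t_j`, i.e. `j ≥ 1`). -/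
theorem dt_rho_entryL {S : ℕ} (hS : 0 < S) {h : ℚ} (h0 : 0 ≤ h) (hh2 : h ≤ 2) {D K Kφ lam Ke ke : ℕ} (hK : 0 < K)
    (hKφ : 0 < Kφ) (hlam : 0 < lam) (j : ℕ) {Q : List ℤ} {e : ℕ} {Qt : List ℤ} {et : ℕ}
    (hchk : rhoPanelCheck S h D Kφ lam Ke ke (PolyMP.panelCentre h j) Q e Qt et = true) :
    TMem S h (fun u ↦ weilArchDensity ((PolyMP.panelCentre h j : ℝ) + u))
      (rhoPanelI S h D K Ke ke (PolyMP.panelCentre h j) Q e Qt et) :=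
  tmem_rhoPanel hS h0 hh2 hK hKφ hlam hchk

/-! ## The even-grid local table of a vector -/

section Tables

variable {S : ℕ} {c : ℚ} {m Dl : ℕ}

/-- The table entry at base `b`: truncation/tail/sup of the exact local expansion, radius `2h`. -/
def dt_tabEntryL (S : ℕ) (c : ℚ) (m Dl : ℕ) (g : Poly) (b : ℚ) : IPoly × ℤ × ℤ :=
  tabEntry S (2 * (c / (2 * m))) Dl (dt_locI S g (ofRat S b))

/-- **Soundness of one table entry** (as an equation to a literal). [folklore] -/
theorem dt_tabOK_of_eq (hS : 0 < S) (hc : 0 < c) (hm : 0 < m) (Dl : ℕ) (g : Poly) (b : ℚ) {e : IPoly × ℤ × ℤ}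
    (he : dt_tabEntryL S c m Dl g b = e) :
    TabOK S (2 * (c / (2 * m))) (fun s ↦ Poly.eval g ((b : ℝ) + s)) e.1 e.2.1 e.2.2 := by
  subst he
  have hmq : (0 : ℚ) < m := by exact_mod_cast hm
  have hR : (0 : ℚ) ≤ 2 * (c / (2 * m)) := by positivity
  obtain ⟨hpm, hev⟩ := dt_locI_spec hS g (mem_ofRat S b)
  exact tabOK_entry hR Dl hpm hev

/-- The length of a table entry is `Dl + 1` when `deg g ≥ Dl`. -/
theorem dt_tabEntryL_length (S : ℕ) (c : ℚ) (m : ℕ) {Dl : ℕ} {g : Poly} (hg : Dl + 1 ≤ g.length) (b : ℚ) :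
    (dt_tabEntryL S c m Dl g b).1.length = Dl + 1 := by
  simp only [dt_tabEntryL, tabEntry, List.length_take, dt_length_locI]
  omega

/-- **One table entry at the grid base `2nh`** (as an equation to a literal), in the form of `dt_VecL.htab`. [folklore] -/
theorem dt_tabOK_at (hS : 0 < S) (hc : 0 < c) (hm : 0 < m) (Dl : ℕ) (g : Poly) (n : ℤ) {e : IPoly × ℤ × ℤ}
    (he : dt_tabEntryL S c m Dl g (2 * n * (c / (2 * m))) = e) :
    TabOK S (2 * (c / (2 * m))) (fun s ↦ Poly.eval g (2 * (n : ℝ) * ((c / (2 * m) : ℚ) : ℝ) + s)) e.1 e.2.1 e.2.2 := by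
  have := dt_tabOK_of_eq hS hc hm Dl g (2 * n * (c / (2 * m))) he
  have e : (fun s ↦ Poly.eval g ((((2 * n * (c / (2 * m)) : ℚ)) : ℝ) + s)) =
      fun s ↦ Poly.eval g (2 * (n : ℝ) * ((c / (2 * m) : ℚ) : ℝ) + s) := by
    funext s; push_cast; ring_nf
  rw [e] at this
  exact this

/-- **The table list**: `tabL` of length `2m+1`, entry `idx` equal to the computed entry at base `2(idx − m)h`, gives the
`htab`/`htabl` fields of `dt_VecL`. [folklore] -/
theorem dt_tabL_spec (hS : 0 < S) (hc : 0 < c) (hm : 0 < m) {Dl : ℕ} {g : Poly} (hg : Dl + 1 ≤ g.length)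
    {tabL : List (IPoly × ℤ × ℤ)} (hlen : tabL.length = 2 * m + 1)
    (h : ∀ idx : Fin tabL.length,
      dt_tabEntryL S c m Dl g (2 * ((idx : ℤ) - m) * (c / (2 * m))) = tabL.get idx) :
    (∀ n : ℤ, -(m : ℤ) ≤ n → n ≤ m →
      TabOK S (2 * (c / (2 * m))) (fun s ↦ Poly.eval g (2 * (n : ℝ) * ((c / (2 * m) : ℚ) : ℝ) + s))
        (tabL.getD (n + m).toNat default).1 (tabL.getD (n + m).toNat default).2.1 (tabL.getD (n + m).toNat default).2.2) ∧
    (∀ n : ℤ, -(m : ℤ) ≤ n → n ≤ m → (tabL.getD (n + m).toNat default).1.length = Dl + 1) := by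
  have key : ∀ n : ℤ, -(m : ℤ) ≤ n → n ≤ m →
      dt_tabEntryL S c m Dl g (2 * n * (c / (2 * m))) = tabL.getD (n + m).toNat default := by
    intro n hn1 hn2
    have hidx : (n + m).toNat < tabL.length := by rw [hlen]; omega
    have := h ⟨(n + m).toNat, hidx⟩
    rw [List.get_eq_getElem] at this
    rw [List.getD_eq_getElem (hn := hidx), ← this]
    congr 2
    have hq : (((n + m).toNat : ℕ) : ℚ) = (n : ℚ) + m := by
      have h0 : 0 ≤ n + m := by omega
      exact_mod_cast Int.toNat_of_nonneg h0
    push_cast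
    rw [hq]
    ring
  refine ⟨fun n hn1 hn2 ↦ ?_, fun n hn1 hn2 ↦ ?_⟩
  · have := dt_tabOK_of_eq hS hc hm Dl g (2 * n * (c / (2 * m))) (key n hn1 hn2)
    have e : (fun s ↦ Poly.eval g ((((2 * n * (c / (2 * m)) : ℚ)) : ℝ) + s)) =
        fun s ↦ Poly.eval g (2 * (n : ℝ) * ((c / (2 * m) : ℚ) : ℝ) + s) := by
      funext s; push_cast; ring_nf
    rw [e] at this
    exact this
  · rw [← key n hn1 hn2]; exact dt_tabEntryL_length S c m hg _

end Tables

/-! ## Moments of the ρ-panel models and G-moments on panel 0 -/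

section Moments

variable {S : ℕ} {c : ℚ} {m Dl : ℕ}

/-- The moment list `∫_{-h}^{h} K(u) u^b du`, `b ≤ Dl`, of a panel model `(W, pw)`. -/
def dt_momsL (S : ℕ) (h : ℚ) (W : IPoly) (pw : Poly) (Dl : ℕ) : List MI :=
  (List.range (Dl + 1)).map fun b ↦ panelIntegI S h W pw (monomialQ b)

/-- **Soundness of the moment list** (as an equation to a literal): for a panel model `W` of `u ↦ ρ(t_i + u)`, `i ≥ 1`.
[folklore] -/
theorem dt_mem_momsL_of_eq (hS : 0 < S) (hc : 0 < c) (hm : 0 < m) {i : ℕ} (hi : 1 ≤ i) {W : IPoly}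
    (hW : TMem S (c / (2 * m)) (fun u ↦ weilArchDensity (((PolyMP.panelCentre (c / (2 * m)) i : ℚ) : ℝ) + u)) W)
    (pw : Poly) (Dl : ℕ) {L : List MI} (hL : dt_momsL S (c / (2 * m)) W pw Dl = L) :
    ∀ b, b < Dl + 1 → MI.mem S (∫ u in (-((c / (2 * m) : ℚ) : ℝ))..((c / (2 * m) : ℚ) : ℝ),
      weilArchDensity (((PolyMP.panelCentre (c / (2 * m)) i : ℚ) : ℝ) + u) * u ^ b) (L.getD b default) := by
  subst hL
  intro b hb
  have hmq : (0 : ℚ) < m := by exact_mod_cast hm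
  have hh0 : (0 : ℚ) ≤ c / (2 * m) := by positivity
  unfold dt_momsL
  rw [getD_map_range _ _ _ hb]
  have := mem_panelIntegI hS hh0 hW (dt_intervalIntegrable_K hc hm hi) pw (monomialQ b)
  simpa [eval_monomialQ] using this

/-- The G-moment list `∫_0^{2h} G t^j dt`, `j < N`, from the panel-0 model `(W0, pw0)` of `u ↦ G(h + u)`. -/
def dt_gmoms0L (S : ℕ) (h : ℚ) (W0 : IPoly) (pw0 : Poly) (N : ℕ) : List MI :=
  (List.range N).map fun j ↦ panelIntegI S h W0 pw0 (dt_shiftMono h j)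

/-- A chunk `j₀ ≤ j < j₀ + n` of the G-moment list (kernel budget). -/
def dt_gmoms0LR (S : ℕ) (h : ℚ) (W0 : IPoly) (pw0 : Poly) (j0 n : ℕ) : List MI :=
  (List.range n).map fun k ↦ panelIntegI S h W0 pw0 (dt_shiftMono h (j0 + k))

/-- The G-moment list in two chunks. -/
theorem dt_gmoms0L_eq_append (S : ℕ) (h : ℚ) (W0 : IPoly) (pw0 : Poly) (a b : ℕ) :
    dt_gmoms0L S h W0 pw0 (a + b) = dt_gmoms0LR S h W0 pw0 0 a ++ dt_gmoms0LR S h W0 pw0 a b := by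
  simp [dt_gmoms0L, dt_gmoms0LR, List.range_add, List.map_append, List.map_map, Function.comp_def]

/-- **Soundness of the G-moment list.** [folklore] -/
theorem dt_mem_gmoms0L_of_eq (hS : 0 < S) (hc : 0 < c) (hm : 0 < m) {W0 : IPoly}
    (hW0 : TMem S (c / (2 * m)) (fun u ↦ weilArchDensityG (((PolyMP.panelCentre (c / (2 * m)) 0 : ℚ) : ℝ) + u)) W0)
    (pw0 : Poly) (N : ℕ) {L : List MI} (hL : dt_gmoms0L S (c / (2 * m)) W0 pw0 N = L) :
    ∀ j, j < L.length → MI.mem S (∫ t in (0 : ℝ)..(2 * ((c / (2 * m) : ℚ) : ℝ)), weilArchDensityG t * t ^ j)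
      (L.getD j default) := by
  subst hL
  intro j hj
  have hmq : (0 : ℚ) < m := by exact_mod_cast hm
  have hh0 : (0 : ℚ) ≤ c / (2 * m) := by positivity
  have hhr : (0 : ℝ) ≤ ((c / (2 * m) : ℚ) : ℝ) := by exact_mod_cast hh0
  unfold dt_gmoms0L at hj ⊢
  rw [List.length_map, List.length_range] at hj
  rw [getD_map_range _ _ _ hj]
  have hGi : IntervalIntegrable (fun u ↦ weilArchDensityG (((PolyMP.panelCentre (c / (2 * m)) 0 : ℚ) : ℝ) + u)) volume
      (-((c / (2 * m) : ℚ) : ℝ)) ((c / (2 * m) : ℚ) : ℝ) := by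
    have h0c : ((PolyMP.panelCentre (c / (2 * m)) 0 : ℚ) : ℝ) = ((c / (2 * m) : ℚ) : ℝ) := by
      simp [PolyMP.panelCentre]
    rw [h0c]
    have := (intervalIntegrable_weilArchDensityG (a := 0) (b := 2 * ((c / (2 * m) : ℚ) : ℝ)) le_rfl (by linarith)).comp_add_left
      (((c / (2 * m) : ℚ) : ℝ))
    convert this using 2 <;> ring
  have := mem_panelIntegI hS hh0 hW0 hGi pw0 (dt_shiftMono (c / (2 * m)) j)
  have e : ∫ u in (-((c / (2 * m) : ℚ) : ℝ))..((c / (2 * m) : ℚ) : ℝ),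
      weilArchDensityG (((PolyMP.panelCentre (c / (2 * m)) 0 : ℚ) : ℝ) + u) *
        Poly.eval (dt_shiftMono (c / (2 * m)) j) u =
      ∫ t in (0 : ℝ)..(2 * ((c / (2 * m) : ℚ) : ℝ)), weilArchDensityG t * t ^ j := by
    have h0c : ((PolyMP.panelCentre (c / (2 * m)) 0 : ℚ) : ℝ) = ((c / (2 * m) : ℚ) : ℝ) := by simp [PolyMP.panelCentre]
    simp_rw [dt_eval_shiftMono, h0c]
    have hcv := intervalIntegral.integral_comp_add_left (fun t ↦ weilArchDensityG t * t ^ j) (((c / (2 * m) : ℚ) : ℝ))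
      (a := -((c / (2 * m) : ℚ) : ℝ)) (b := ((c / (2 * m) : ℚ) : ℝ))
    simp only [add_neg_cancel] at hcv
    rw [hcv]
    congr 1; ring
  rw [← e]
  exact this

end Moments

end Summit.RiemannHypothesis.RiemannHypothesis.Theorems.EvenWinsBeyondArch

end
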